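import Summits.NavierStokesRegularity.NavierStokesRegularity.Theorems.PerpetualPumpCircuitPumpActiveCoreShift

/-!
# Active block of the Toda pump over one period (crux `PerpetualPump.CircuitPump`,
# stmt-NavierStokesRegularity-1834; line `singular-clock-gspt`, sub-goal `toda_active_core` of
# `stub_clockBox`, Toda `m = 2` instance)

The four active modes `(u, v, w, z)` of the seeded graded Toda pump over one window. Items
(i)–(v) (global brackets, the gate time `tg ∈ [τ⁻, τ⁺]`, the flip, the radius at `t₃`, the
post-`t₃` pinning) are `toda_active_shift` (`Theorems/PerpetualPumpCircuitPumpActiveCoreShift.lean`,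
via the abstract period theorem `toda_gate_period`). Item (vi), the two-sided bracket of the new
bond `z` at `t₃`, is proved here from `z' = z(lam(w − y) − ν) + ε lam w²`:
* lower: on `J = [τ⁺ + 250/A, t₃]` (length `16 log A/A`) the gate is flipped, `w ≥ 3A/10 − 1`, the
  rate is non-negative and the seed is `≥ ε(3A/10 − 1)²`, so `z(t₃) ≥ εA` (`seed_lower`);
* upper: two seed barriers (`seed_barrier`): on `[0, tg]` with the super-solution exponent
  `Φ = (3/2)v²/A² + 6t` (the bond growth `2vv' ≥ Av²` during the rise makes `(3/2)v²/A²` dominate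
  the rate contribution `(3/2)v²/A` of the new carrier, `w ≤ 1 + v²/A + 3t` by the barrier
  `core_wbar`), and on `[tg, t₃]` (length `≤ (255 + 16 log A)/A`) with the constant rate
  `lam(A + 2) − 1`; the bookkeeping `core_pt_zlog` gives `log z(t₃) ≤ log ε + 26 log A + 384`.
[folklore]
-/

noncomputable section

-- the summit namespace `…NavierStokesRegularity.NavierStokesRegularity…` is the tree convention
set_option linter.dupNamespace false

namespace Summit.NavierStokesRegularity.NavierStokesRegularity.Theorems.PerpetualPumpCircuitPump

open Set Filter Topology Literature.Analysis.ODE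

/-- **Rise barrier for the new carrier (unshifted).** While `u − w ≥ A/2 + 1` on `[0, tg]`
(so `(v²/A)' ≥ v²`) and the perturbation `r = −lam z² − ε lam w z ≤ 3`:
`(1 + v²/A + 3t − w)' ≥ −ν (1 + v²/A + 3t − w)`, hence `w ≤ 1 + v²/A + 3t` from `w(0) ≤ 1`.
[folklore] -/
theorem core_wbar {ν ε lam A T tg : ℝ} {u v w z : ℝ → ℝ} (hν1 : 1 ≤ ν) (hε : 0 ≤ ε) (hA : 0 < A)
    (htg : tg ≤ T) (hv : ContinuousOn v (Icc 0 T)) (hw : ContinuousOn w (Icc 0 T))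
    (hv' : ∀ t ∈ Ico 0 T, HasDerivWithinAt v (v t * (u t - w t) - v t + ε * u t ^ 2) (Ici t) t)
    (hw' : ∀ t ∈ Ico 0 T, HasDerivWithinAt w
      (-ν * w t + v t ^ 2 - lam * z t ^ 2 - ε * lam * w t * z t) (Ici t) t)
    (hr : ∀ t ∈ Icc 0 T, -lam * z t ^ 2 - ε * lam * w t * z t ≤ 3)
    (hvp : ∀ t ∈ Icc 0 T, 0 ≤ v t) (hD : ∀ t ∈ Icc 0 tg, A / 2 + 1 ≤ u t - w t)
    (hw0 : w 0 ≤ 1) : ∀ t ∈ Icc 0 tg, w t ≤ 1 + v t ^ 2 / A + 3 * t := by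
  intro t ht
  have hI' : ∀ x ∈ Ico 0 tg, x ∈ Ico 0 T := fun x hx => ⟨hx.1, hx.2.trans_le htg⟩
  have hvv : ∀ x ∈ Ico 0 tg,
      v x ^ 2 ≤ 2 * v x * (v x * (u x - w x) - v x + ε * u x ^ 2) / A := by
    intro x hx
    rw [le_div_iff₀ hA]
    have hx0 := hvp x (Ico_subset_Icc_self (hI' x hx))
    have h1 := mul_nonneg (mul_nonneg hx0 hx0)
      (by linarith [hD x (Ico_subset_Icc_self hx)] : (0 : ℝ) ≤ u x - w x - 1 - A / 2)
    nlinarith [mul_nonneg hx0 (mul_nonneg hε (sq_nonneg (u x)))]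
  have hv2 : ∀ x ∈ Ico 0 tg, HasDerivWithinAt (fun y => v y ^ 2 / A)
      (2 * v x * (v x * (u x - w x) - v x + ε * u x ^ 2) / A) (Ici x) x := fun x hx =>
    (((hv' x (hI' x hx)).fun_pow 2).div_const A).congr_deriv (by norm_num)
  have hf' : ∀ x ∈ Ico 0 tg, HasDerivWithinAt (fun y => 1 + v y ^ 2 / A + 3 * y - w y)
      (2 * v x * (v x * (u x - w x) - v x + ε * u x ^ 2) / A + 3 * 1 -
        (-ν * w x + v x ^ 2 - lam * z x ^ 2 - ε * lam * w x * z x)) (Ici x) x := fun x hx =>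
    (((hv2 x hx).const_add 1).fun_add
      (((hasDerivAt_id' x).const_mul 3).hasDerivWithinAt)).fun_sub (hw' x (hI' x hx))
  have hfc : ContinuousOn (fun y => 1 + v y ^ 2 / A + 3 * y - w y) (Icc 0 tg) :=
    ContinuousOn.mono (by fun_prop) (Icc_subset_Icc_right htg)
  have h := exp_mul_le_of_le_deriv_right (β := -ν) hfc hf' (fun x hx => by
    have hrx := hr x (Ico_subset_Icc_self (hI' x hx))
    have hν0 : (0 : ℝ) ≤ ν := by linarith
    have h3 := mul_nonneg (mul_nonneg hν0 (by norm_num : (0 : ℝ) ≤ 3)) hx.1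
    have h4 := mul_nonneg hν0 (div_nonneg (sq_nonneg (v x)) hA.le)
    nlinarith [hvv x hx]) t ht
  simp only [mul_zero, add_zero, sub_zero] at h
  have h0 : (0 : ℝ) ≤ 1 + v 0 ^ 2 / A - w 0 := by
    have := div_nonneg (sq_nonneg (v 0)) hA.le
    linarith
  nlinarith [mul_nonneg h0 (Real.exp_pos (-ν * t)).le]

/-- Pointwise size of the perturbation `r = −lam z² − ε lam w z ≤ 3` (`0 ≤ z ≤ 1`, `w ≥ −2`).
[folklore] -/
theorem core_pt_r {lam ε A W Z : ℝ} (hlam0 : 0 ≤ lam) (hlam2 : lam ≤ 3 / 2) (hε : 0 ≤ ε)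
    (hA : 40000 ≤ A) (hεA1 : ε * (A + 1) ≤ 1) (hz0 : 0 ≤ Z) (hz1 : Z ≤ 1) (hWlo : -2 ≤ W) :
    -lam * Z ^ 2 - ε * lam * W * Z ≤ 3 := by
  have h1 : 0 ≤ lam * Z ^ 2 := by positivity
  have h2 : -(ε * lam * W * Z) ≤ ε * lam * Z * 2 := by
    have := mul_le_mul_of_nonneg_left hWlo (by positivity : (0 : ℝ) ≤ ε * lam * Z)
    linarith
  have hε1 : ε ≤ 1 := by nlinarith
  have h3 : ε * lam * Z * 2 ≤ 1 * (3 / 2) * 1 * 2 :=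
    mul_le_mul_of_nonneg_right (mul_le_mul (mul_le_mul hε1 hlam2 hlam0 zero_le_one) hz1 hz0
      (by positivity)) (by norm_num)
  linarith

/-- Pointwise rate bound during the rise: `lam(w − y) − ν ≤ (3/2)(2vv')/A² + 6` when
`w ≤ 1 + v²/A + 3t`, `w ≥ −2`, `|y| ≤ 1`, `lam ∈ [1, 3/2]`, and the bond grows (`u − w ≥ A/2 + 1`,
so `2vv' ≥ Av²`). [folklore] -/
theorem core_pt_rate_rise {lam ν ε A t U V W Y : ℝ} (hlam1 : 1 ≤ lam) (hlam2 : lam ≤ 3 / 2)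
    (hν1 : 1 ≤ ν) (hε : 0 ≤ ε) (hA : 0 < A) (ht : t ≤ 1 / 2) (hV0 : 0 ≤ V) (hY : |Y| ≤ 1)
    (hD : A / 2 + 1 ≤ U - W) (hWlo : -2 ≤ W) (hWup : W ≤ 1 + V ^ 2 / A + 3 * t) :
    lam * (W - Y) - ν ≤ 3 / 2 * (2 * V * (V * (U - W) - V + ε * U ^ 2)) / A ^ 2 + 6 := by
  obtain ⟨hY1, -⟩ := abs_le.mp hY
  have h1 : lam * W ≤ 3 / 2 * W + 1 := by
    nlinarith [mul_nonneg (sub_nonneg.2 hlam2) (by linarith : (0 : ℝ) ≤ W + 2)]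
  have h2 : -(lam * Y) ≤ lam := by
    nlinarith [mul_le_mul_of_nonneg_left hY1 (by linarith : (0 : ℝ) ≤ lam)]
  have h3 : A * V ^ 2 ≤ 2 * V * (V * (U - W) - V + ε * U ^ 2) := by
    have := mul_nonneg (mul_nonneg hV0 hV0) (by linarith : (0 : ℝ) ≤ U - W - 1 - A / 2)
    nlinarith [mul_nonneg hV0 (mul_nonneg hε (sq_nonneg U))]
  have h4 : 3 / 2 * (V ^ 2 / A) ≤ 3 / 2 * (2 * V * (V * (U - W) - V + ε * U ^ 2)) / A ^ 2 := by
    rw [mul_div_assoc]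
    apply mul_le_mul_of_nonneg_left _ (by norm_num)
    rw [div_le_div_iff₀ hA (by positivity)]
    nlinarith [mul_le_mul_of_nonneg_left h3 hA.le]
  nlinarith [h1, h2, h4, hWup, ht]

/-- Pointwise rate bound after the gate time: `lam(w − y) − ν ≤ lam(A + 2) − 1`. [folklore] -/
theorem core_pt_rate_flip {lam ν A W Y : ℝ} (hlam0 : 0 ≤ lam) (hν1 : 1 ≤ ν) (hY : |Y| ≤ 1)
    (hW : W ≤ A + 1) : lam * (W - Y) - ν ≤ lam * (A + 2) - 1 := by
  obtain ⟨hY1, -⟩ := abs_le.mp hY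
  have := mul_le_mul_of_nonneg_left (by linarith : W - Y ≤ A + 2) hlam0
  linarith

/-- Pointwise seed size during the rise: `0 ≤ ε lam w² ≤ (3/2) ε (A/64 + 3)²`
(`−2 ≤ w ≤ 1 + v²/A + 3t`, `v ≤ A/8`). [folklore] -/
theorem core_pt_q1 {lam ε A t V W : ℝ} (hlam0 : 0 ≤ lam) (hlam2 : lam ≤ 3 / 2) (hε : 0 ≤ ε)
    (hA : 40000 ≤ A) (hV0 : 0 ≤ V) (hV8 : V ≤ A / 8) (ht : t ≤ 1 / 2) (hWlo : -2 ≤ W)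
    (hWup : W ≤ 1 + V ^ 2 / A + 3 * t) :
    0 ≤ ε * lam * W ^ 2 ∧ ε * lam * W ^ 2 ≤ 3 / 2 * ε * (A / 64 + 3) ^ 2 := by
  have hA0 : 0 < A := by linarith
  have hv2 : V ^ 2 / A ≤ A / 64 := by
    rw [div_le_iff₀ hA0]; nlinarith [pow_le_pow_left₀ hV0 hV8 2]
  have hWhi : W ≤ A / 64 + 3 := by linarith
  have hW2 : W ^ 2 ≤ (A / 64 + 3) ^ 2 := sq_le_sq' (by linarith) hWhi
  refine ⟨by positivity, ?_⟩
  calc ε * lam * W ^ 2 ≤ ε * (3 / 2) * (A / 64 + 3) ^ 2 :=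
        mul_le_mul (mul_le_mul_of_nonneg_left hlam2 hε) hW2 (sq_nonneg _) (by positivity)
    _ = 3 / 2 * ε * (A / 64 + 3) ^ 2 := by ring

/-- Pointwise seed size in general: `0 ≤ ε lam w² ≤ (3/2) ε (A + 1)²` (`−2 ≤ w ≤ A + 1`).
[folklore] -/
theorem core_pt_q2 {lam ε A W : ℝ} (hlam0 : 0 ≤ lam) (hlam2 : lam ≤ 3 / 2) (hε : 0 ≤ ε)
    (hA : 40000 ≤ A) (hWlo : -2 ≤ W) (hWhi : W ≤ A + 1) :
    0 ≤ ε * lam * W ^ 2 ∧ ε * lam * W ^ 2 ≤ 3 / 2 * ε * (A + 1) ^ 2 := by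
  have hW2 : W ^ 2 ≤ (A + 1) ^ 2 := sq_le_sq' (by linarith) hWhi
  refine ⟨by positivity, ?_⟩
  calc ε * lam * W ^ 2 ≤ ε * (3 / 2) * (A + 1) ^ 2 :=
        mul_le_mul (mul_le_mul_of_nonneg_left hlam2 hε) hW2 (sq_nonneg _) (by positivity)
    _ = 3 / 2 * ε * (A + 1) ^ 2 := by ring

/-- Pointwise lower bookkeeping: `z(t₃) ≥ z(a) + ε(3A/10 − 1)²·(16 log A/A) ≥ εA`. [folklore] -/
theorem core_pt_zlow {ε A L J za z3 : ℝ} (hA : 40000 ≤ A) (hε : 0 < ε) (hL1 : 1 ≤ L)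
    (hJ : J = 16 * L / A) (hza : 0 ≤ za) (hz : za + ε * (3 * A / 10 - 1) ^ 2 * J ≤ z3) :
    ε * A ≤ z3 := by
  have hA0 : 0 < A := by linarith
  have hm2 : A * A ≤ (3 * A / 10 - 1) ^ 2 * (16 * L) := by
    have h1 : A * A ≤ (3 * A / 10 - 1) ^ 2 * 16 := by nlinarith
    have h2 : (3 * A / 10 - 1) ^ 2 * 16 * 1 ≤ (3 * A / 10 - 1) ^ 2 * 16 * L :=
      mul_le_mul_of_nonneg_left hL1 (by positivity)
    nlinarith
  have h3 : A ≤ (3 * A / 10 - 1) ^ 2 * J := by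
    rw [hJ, mul_div_assoc', le_div_iff₀ hA0]; nlinarith
  nlinarith [mul_le_mul_of_nonneg_left h3 hε.le]

/-- Pointwise upper bookkeeping of the two seed barriers: with `z(0) ≤ ε`, the rise barrier
(`e^{Φ(tg) − Φ(0)} ≤ e⁴ ≤ 55`, seed `(3/2)ε(A/64 + 3)² tg`) gives `z(tg) ≤ εA²/50`, and the second
barrier (rate `≤ 3A/2 + 2` for a time `δ ≤ (255 + 16 log A)/A ≤ 0.51`, seed `(3/2)ε(A + 1)²δ`) gives
`log z(t₃) ≤ (384 + 24 log A) + log ε + 2 log A`. [folklore] -/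
theorem core_pt_zlog {ε A L K δ tg z0 ztg z3 E1 : ℝ} (hA : 40000 ≤ A) (hε : 0 < ε)
    (hL : Real.log A = L) (hL0 : 0 ≤ L) (h16 : 16 * L / A ≤ 1 / 2) (hz0 : 0 ≤ z0) (hz0' : z0 ≤ ε)
    (htg0 : 0 ≤ tg) (htg : tg ≤ 1 / 2) (hE1 : E1 ≤ Real.exp 4)
    (hztg : ztg ≤ E1 * (z0 + 3 / 2 * ε * (A / 64 + 3) ^ 2 * (tg - 0)))
    (hK : K ≤ 3 / 2 * A + 2) (hδ0 : 0 ≤ δ) (hδ : δ ≤ (255 + 16 * L) / A)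
    (hz3 : z3 ≤ Real.exp (K * δ) * (ztg + 3 / 2 * ε * (A + 1) ^ 2 * δ)) (hz3pos : 0 < z3) :
    Real.log z3 ≤ Real.log ε + 27 * L + 400 := by
  have hA0 : 0 < A := by linarith
  have he4 : Real.exp 4 ≤ 55 := by
    have h : Real.exp 4 = Real.exp 1 ^ 4 := by rw [← Real.exp_nat_mul]; norm_num
    rw [h]
    have h1 := Real.exp_one_lt_d9
    have h2 := pow_le_pow_left₀ (Real.exp_pos 1).le h1.le 4
    exact h2.trans (by norm_num)
  -- first barrier
  have hQ1 : 3 / 2 * ε * (A / 64 + 3) ^ 2 * (tg - 0) ≤ ε * A ^ 2 / 4800 := by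
    have h1 : (A / 64 + 3) ^ 2 ≤ A ^ 2 / 3600 := by nlinarith
    have h2 : 3 / 2 * ε * (A / 64 + 3) ^ 2 * (tg - 0) ≤ 3 / 2 * ε * (A / 64 + 3) ^ 2 * (1 / 2) :=
      mul_le_mul_of_nonneg_left (by linarith) (by positivity)
    nlinarith [mul_le_mul_of_nonneg_left h1 hε.le]
  have hin1 : 0 ≤ z0 + 3 / 2 * ε * (A / 64 + 3) ^ 2 * (tg - 0) := by
    have : 0 ≤ 3 / 2 * ε * (A / 64 + 3) ^ 2 * (tg - 0) :=
      mul_nonneg (by positivity) (by linarith)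
    linarith
  have hztg' : ztg ≤ ε * A ^ 2 / 50 := by
    have h1 : E1 * (z0 + 3 / 2 * ε * (A / 64 + 3) ^ 2 * (tg - 0)) ≤
        55 * (ε + ε * A ^ 2 / 4800) :=
      (mul_le_mul_of_nonneg_right (hE1.trans he4) hin1).trans
        (mul_le_mul_of_nonneg_left (by linarith) (by norm_num))
    have h2 : 55 * (ε + ε * A ^ 2 / 4800) ≤ ε * A ^ 2 / 50 := by
      nlinarith [mul_le_mul_of_nonneg_left (show (40000 : ℝ) ^ 2 ≤ A ^ 2 by nlinarith) hε.le]
    linarith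
  -- second barrier
  have h255 : 255 / A ≤ 1 / 100 := by rw [div_le_iff₀ hA0]; linarith
  have hδ1 : δ ≤ 51 / 100 := by
    have : (255 + 16 * L) / A = 255 / A + 16 * L / A := by rw [add_div]
    linarith
  have hin2 : ztg + 3 / 2 * ε * (A + 1) ^ 2 * δ ≤ ε * A ^ 2 := by
    have h1 : 3 / 2 * ε * (A + 1) ^ 2 * δ ≤ 3 / 2 * ε * (A + 1) ^ 2 * (51 / 100) :=
      mul_le_mul_of_nonneg_left hδ1 (by positivity)
    nlinarith [mul_le_mul_of_nonneg_left (show (A + 1) ^ 2 ≤ 51 / 50 * A ^ 2 by nlinarith) hε.le]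
  have hKδ : K * δ ≤ 384 + 24 * L := by
    have h1 : K * δ ≤ (3 / 2 * A + 2) * δ := mul_le_mul_of_nonneg_right hK hδ0
    have h2 : (3 / 2 * A + 2) * δ ≤ (3 / 2 * A + 2) * ((255 + 16 * L) / A) :=
      mul_le_mul_of_nonneg_left hδ (by positivity)
    have h3 : (3 / 2 * A + 2) * ((255 + 16 * L) / A) =
        3 / 2 * (255 + 16 * L) + 2 * (255 / A) + 2 * (16 * L / A) := by
      field_simp; ring
    linarith
  have hexp0 := Real.exp_pos (K * δ)
  have hz3' : z3 ≤ Real.exp (K * δ) * (ε * A ^ 2) :=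
    hz3.trans (mul_le_mul_of_nonneg_left hin2 hexp0.le)
  have hlog := Real.log_le_log hz3pos hz3'
  have e2 : Real.log (A ^ 2) = 2 * Real.log A := by rw [Real.log_pow]; norm_num
  rw [Real.log_mul hexp0.ne' (by positivity), Real.log_exp, Real.log_mul hε.ne' (by positivity),
    e2, hL] at hlog
  linarith

/-- **ACTIVE-BLOCK CORE.** The four active modes of the Toda pump over one window, in raw units at the
active scale: old carrier `u` (rate 1), old bond `v`, new carrier `w` (rate `ν = lam^{4/5}`), new bond `z`
(at scale 1: coupling `lam`, rate `ν`), with the environment entering only through the spent bond behind,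
`e` (influx `e²/lam ≥ 0` into `u`), and the precursor carrier ahead, `y` (in `z`'s rate), both assumed
`O(1)`-bounded, and `z ≤ 1` (no second hop) — from SECTION DATA `u(0) = A`, `v(0) = √ε` (pinned phase),
`w(0) ∈ [−ε², ε^{3/4}]`, `z(0) ∈ [0, ε^{3/2}]`. With `ℓ₁ := −(log ε)/2 + log(A/8)` (the first half fuse),
`τ⁻ := −log(1 − (ℓ₁ − 6/5)/A)`, `τ⁺ := −log(1 − (ℓ₁ + 11/5)/A)` (rise-end bracket) and
`t₃ := τ⁺ + (250 + 16 log A)/A` (flip done, old bond dead), the conclusions chain `toda_rise_clock`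
(applied to `u, v, w̃ := w + ε² e^{−νt}`, seed `s̃ = εu² + ε²e^{−νt}v`, `P = 3`), `toda_gate_sigma`,
`toda_gate_flip_dynamics` (entry at the first time `v = A/8`: `H = R − D = 2v²/(R + D) ≥ A/80`),
`toda_gate_R`: (i) global brackets (energy `(√(u²+v²+w²))' ≤ 4`); (ii) the old bond reaches `A/8` at some
`t_g ∈ [τ⁻, τ⁺]` and not before; (iii) for `t ≥ τ⁺ + 250/A` the gate is flipped and `v` decays;
(iv) at `t₃` the gate radius is `A e^{−t_g} ± (900 + 50 log A)` (`|S'| ≤ 5A/2` across the short core,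
`|σ| ≤ 15`); (v) for `t ≥ t₃` the new carrier follows `R(t₃) e^{−ν(t−t₃)}` within `30`, the old bond is `≤ 2`,
the old carrier `|u| ≤ 13` (the residual); (vi) two-sided bracket of `log z(t₃)`. All constants have slack
(they absorb the `ε²`-shift). -/
theorem toda_active_core :
    ∀ (lam ν ε A T : ℝ) (u v w z e y : ℝ → ℝ),
    1 < lam → lam ≤ 3 / 2 → ν = lam ^ (4 / 5 : ℝ) → 0 < ε → 0 < T → T ≤ 1 / 2 →
    40000 ≤ A → -Real.log ε ≤ A / 5 → ε * (A + 2) ^ 2 ≤ 1 → Real.sqrt ε * A ≤ 1 / 40 →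
    (-Real.log (1 - (-(Real.log ε) / 2 + Real.log (A / 8) + 11 / 5) / A) + (250 + 16 * Real.log A) / A) ≤ T →
    u 0 = A → v 0 = Real.sqrt ε → -ε ^ 2 ≤ w 0 → w 0 ≤ ε ^ (3 / 4 : ℝ) → 0 ≤ z 0 → z 0 ≤ ε ^ (3 / 2 : ℝ) →
    ContinuousOn u (Set.Icc 0 T) → ContinuousOn v (Set.Icc 0 T) → ContinuousOn w (Set.Icc 0 T) →
    ContinuousOn z (Set.Icc 0 T) → ContinuousOn e (Set.Icc 0 T) → ContinuousOn y (Set.Icc 0 T) →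
    (∀ t ∈ Set.Ico 0 T, HasDerivWithinAt u
      (-u t - v t ^ 2 + lam⁻¹ * e t ^ 2 - ε * u t * v t) (Set.Ici t) t) →
    (∀ t ∈ Set.Ico 0 T, HasDerivWithinAt v (v t * (u t - w t) - v t + ε * u t ^ 2) (Set.Ici t) t) →
    (∀ t ∈ Set.Ico 0 T, HasDerivWithinAt w
      (-ν * w t + v t ^ 2 - lam * z t ^ 2 - ε * lam * w t * z t) (Set.Ici t) t) →
    (∀ t ∈ Set.Ico 0 T, HasDerivWithinAt z
      (z t * (lam * (w t - y t) - ν) + ε * lam * w t ^ 2) (Set.Ici t) t) →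
    (∀ t ∈ Set.Icc 0 T, 0 ≤ e t ∧ e t ≤ 1) → (∀ t ∈ Set.Icc 0 T, |y t| ≤ 1) →
    (∀ t ∈ Set.Icc 0 T, z t ≤ 1) →
    (∀ t ∈ Set.Icc 0 T, 0 ≤ v t ∧ v t ≤ A + 3 ∧ -13 ≤ u t ∧ u t ≤ A + 3 ∧ -2 ≤ w t ∧ w t ≤ A + 3 ∧
      0 ≤ z t ∧ A / 4 ≤ Real.sqrt ((u t - w t) ^ 2 + 2 * v t ^ 2)) ∧
    (∃ tg : ℝ, (-Real.log (1 - (-(Real.log ε) / 2 + Real.log (A / 8) - 6 / 5) / A)) ≤ tg ∧ tg ≤ (-Real.log (1 - (-(Real.log ε) / 2 + Real.log (A / 8) + 11 / 5) / A)) ∧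
      v tg = A / 8 ∧ (∀ t ∈ Set.Icc 0 tg, v t ≤ A / 8) ∧
      (∀ t ∈ Set.Icc ((-Real.log (1 - (-(Real.log ε) / 2 + Real.log (A / 8) + 11 / 5) / A)) + 250 / A) T,
        u t - w t ≤ -(4 / 5) * Real.sqrt ((u t - w t) ^ 2 + 2 * v t ^ 2) ∧
        v t ≤ A * Real.exp (-(A / 4) * (t - ((-Real.log (1 - (-(Real.log ε) / 2 + Real.log (A / 8) + 11 / 5) / A)) + 250 / A))) + 30 / A) ∧
      |Real.sqrt ((u (-Real.log (1 - (-(Real.log ε) / 2 + Real.log (A / 8) + 11 / 5) / A) + (250 + 16 * Real.log A) / A) - w (-Real.log (1 - (-(Real.log ε) / 2 + Real.log (A / 8) + 11 / 5) / A) + (250 + 16 * Real.log A) / A)) ^ 2 + 2 * v (-Real.log (1 - (-(Real.log ε) / 2 + Real.log (A / 8) + 11 / 5) / A) + (250 + 16 * Real.log A) / A) ^ 2) - A * Real.exp (-tg)| ≤ 900 + 50 * Real.log A) ∧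
    (∀ t ∈ Set.Icc (-Real.log (1 - (-(Real.log ε) / 2 + Real.log (A / 8) + 11 / 5) / A) + (250 + 16 * Real.log A) / A) T,
      |w t - Real.sqrt ((u (-Real.log (1 - (-(Real.log ε) / 2 + Real.log (A / 8) + 11 / 5) / A) + (250 + 16 * Real.log A) / A) - w (-Real.log (1 - (-(Real.log ε) / 2 + Real.log (A / 8) + 11 / 5) / A) + (250 + 16 * Real.log A) / A)) ^ 2 + 2 * v (-Real.log (1 - (-(Real.log ε) / 2 + Real.log (A / 8) + 11 / 5) / A) + (250 + 16 * Real.log A) / A) ^ 2) * Real.exp (-ν * (t - (-Real.log (1 - (-(Real.log ε) / 2 + Real.log (A / 8) + 11 / 5) / A) + (250 + 16 * Real.log A) / A)))| ≤ 30 ∧ v t ≤ 2 ∧ |u t| ≤ 13) ∧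
    (0 < z (-Real.log (1 - (-(Real.log ε) / 2 + Real.log (A / 8) + 11 / 5) / A) + (250 + 16 * Real.log A) / A) ∧ Real.log ε + Real.log A ≤ Real.log (z (-Real.log (1 - (-(Real.log ε) / 2 + Real.log (A / 8) + 11 / 5) / A) + (250 + 16 * Real.log A) / A)) ∧
      Real.log (z (-Real.log (1 - (-(Real.log ε) / 2 + Real.log (A / 8) + 11 / 5) / A) + (250 + 16 * Real.log A) / A)) ≤ Real.log ε + 27 * Real.log A + 400)  := by
  intro lam ν ε A T u v w z e y hlam1 hlam2 hν hε hT0 hT hA hΛ hεA hsεA ht3T hu0 hv0 hw0lo hw0hi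
    hz0 hz0' hu hv hw hz he hy hu' hv' hw' hz' heb hyb hzb
  obtain ⟨hI, tg, htgm, htgp, htg0, ht3tg, hvtg, hrise, hIII, hIV, hV⟩ :=
    toda_active_shift lam ν ε A T u v w z e y hlam1 hlam2 hν hε hT0 hT hA hΛ hεA hsεA ht3T hu0 hv0
      hw0lo hw0hi hz0 hz0' hu hv hw hz he hy hu' hv' hw' hz' heb hyb hzb
  set τp : ℝ := -Real.log (1 - (-(Real.log ε) / 2 + Real.log (A / 8) + 11 / 5) / A) with hτp
  set t₃ : ℝ := τp + (250 + 16 * Real.log A) / A with ht₃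
  obtain ⟨hν1, hν2, -, -, hεA1, -, hsε0, -, h34, h32, -, -, -⟩ :=
    shift_numerics hlam1 hlam2 hν hε hA hΛ hεA hsεA
  have hA0 : 0 < A := by linarith only [hA]
  have hlam0 : 0 ≤ lam := by linarith only [hlam1]
  have hlogA0 : 0 ≤ Real.log A := Real.log_nonneg (by linarith only [hA])
  have hlogA1 : 1 ≤ Real.log A := by
    rw [Real.le_log_iff_exp_le hA0]
    linarith only [Real.exp_one_lt_d9, hA]
  have h250A : (0 : ℝ) ≤ 250 / A := by positivity
  have hJ : t₃ - (τp + 250 / A) = 16 * Real.log A / A := by rw [ht₃]; field_simp; ring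
  have h16A : 0 ≤ 16 * Real.log A / A := by positivity
  have haJ : τp + 250 / A ≤ t₃ := by linarith only [hJ, h16A]
  have ha0 : 0 ≤ τp + 250 / A := by linarith only [htg0, htgp, h250A]
  have htgT : tg ≤ T := by linarith only [htgp, haJ, ht3T, h250A]
  have htgt₃ : tg ≤ t₃ := by linarith only [htgp, haJ, h250A]
  have ht₃0 : 0 ≤ t₃ := ha0.trans haJ
  ---------------------------------------------------------------- (vi) lower bound
  have hzlow := seed_lower (m := 3 * A / 10 - 1) haJ (hz.mono (Icc_subset_Icc ha0 ht3T))
    (fun t ht => hz' t ⟨ha0.trans ht.1, ht.2.trans_le ht3T⟩)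
    (fun t ht => (hI t ⟨ha0.trans ht.1, ht.2.trans ht3T⟩).2.2.2.2.2.2.1)
    (fun t ht => (hIII t ⟨ht.1, ht.2.trans ht3T⟩).2.2)
    (fun t ht => hyb t ⟨ha0.trans ht.1, ht.2.trans ht3T⟩) hlam1.le hε.le
    (by linarith only [hA])
    (by
      have h := mul_le_mul_of_nonneg_right hlam1.le
        (by linarith only [hA] : (0 : ℝ) ≤ 3 * A / 10 - 1 - 1)
      linarith only [h, hν2, hA])
  have hza : 0 ≤ z (τp + 250 / A) := (hI _ ⟨ha0, haJ.trans ht3T⟩).2.2.2.2.2.2.1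
  have hz3 : ε * A ≤ z t₃ := core_pt_zlow hA hε hlogA1 hJ hza hzlow
  have hεA0 : 0 < ε * A := by positivity
  have hz3pos : 0 < z t₃ := hεA0.trans_le hz3
  have hlow : Real.log ε + Real.log A ≤ Real.log (z t₃) := by
    rw [← Real.log_mul hε.ne' hA0.ne']
    exact Real.log_le_log hεA0 hz3
  ---------------------------------------------------------------- (vi) upper bound
  -- the refined rise bound for the new carrier
  have hwbar := core_wbar hν1 hε.le hA0 htgT hv hw hv' hw'
    (fun t ht => core_pt_r hlam0 hlam2 hε.le hA hεA1 (hI t ht).2.2.2.2.2.2.1 (hzb t ht)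
      (hI t ht).2.2.2.2.1)
    (fun t ht => (hI t ht).1) (fun t ht => (hrise t ht).2.2.1)
    (by linarith only [hw0hi, h34, sq_nonneg ε])
  -- first barrier on `[0, tg]`
  have hΦc : ContinuousOn (fun y => 3 / 2 * v y ^ 2 / A ^ 2 + 6 * y) (Icc 0 tg) :=
    ContinuousOn.mono (by fun_prop) (Icc_subset_Icc_right htgT)
  have hΦ' : ∀ t ∈ Ico 0 tg, HasDerivWithinAt (fun y => 3 / 2 * v y ^ 2 / A ^ 2 + 6 * y)
      (3 / 2 * (2 * v t * (v t * (u t - w t) - v t + ε * u t ^ 2)) / A ^ 2 + 6) (Ici t) t := by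
    intro t ht
    have ht' : t ∈ Ico 0 T := ⟨ht.1, ht.2.trans_le htgT⟩
    refine (((((hv' t ht').fun_pow 2).const_mul (3 / 2)).div_const (A ^ 2)).add
      (((hasDerivAt_id' t).const_mul 6).hasDerivWithinAt)).congr_deriv ?_
    norm_num
  have hst1 : z tg ≤ Real.exp (3 / 2 * v tg ^ 2 / A ^ 2 + 6 * tg - (3 / 2 * v 0 ^ 2 / A ^ 2 + 6 * 0)) *
      (z 0 + 3 / 2 * ε * (A / 64 + 3) ^ 2 * (tg - 0)) :=
    seed_barrier (z := z) (Φ := fun y => 3 / 2 * v y ^ 2 / A ^ 2 + 6 * y)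
      (c := fun t => lam * (w t - y t) - ν) (q := fun t => ε * lam * w t ^ 2)
      (Φ' := fun t => 3 / 2 * (2 * v t * (v t * (u t - w t) - v t + ε * u t ^ 2)) / A ^ 2 + 6)
      htg0 (hz.mono (Icc_subset_Icc_right htgT)) hΦc
      (fun t ht => hz' t ⟨ht.1, ht.2.trans_le htgT⟩) hΦ'
      (fun t ht => by
        have ht' : t ∈ Icc 0 T := ⟨ht.1, ht.2.le.trans htgT⟩
        obtain ⟨-, -, hD, -⟩ := hrise t (Ico_subset_Icc_self ht)
        exact core_pt_rate_rise hlam1.le hlam2 hν1 hε.le hA0 (by linarith only [ht.2, htgT, hT])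
          (hI t ht').1 (hyb t ht') hD (hI t ht').2.2.2.2.1 (hwbar t (Ico_subset_Icc_self ht)))
      (fun t ht => (hI t ⟨ht.1, ht.2.trans htgT⟩).2.2.2.2.2.2.1)
      (fun t ht => by
        have ht' : t ∈ Icc 0 T := ⟨ht.1, ht.2.le.trans htgT⟩
        obtain ⟨-, hv8, -, -⟩ := hrise t (Ico_subset_Icc_self ht)
        exact core_pt_q1 hlam0 hlam2 hε.le hA (hI t ht').1 hv8
          (by linarith only [ht.2, htgT, hT]) (hI t ht').2.2.2.2.1
          (hwbar t (Ico_subset_Icc_self ht)))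
      (fun t ht => by
        obtain ⟨hv0t, -, -, -⟩ := hrise t ht
        have hv00 : 0 ≤ v 0 := (hI 0 ⟨le_rfl, hT0.le⟩).1
        have h1 := div_le_div_of_nonneg_right (pow_le_pow_left₀ hv00 hv0t 2) (sq_nonneg A)
        show 3 / 2 * v 0 ^ 2 / A ^ 2 + 6 * 0 ≤ 3 / 2 * v t ^ 2 / A ^ 2 + 6 * t
        have e1 : 3 / 2 * v 0 ^ 2 / A ^ 2 = 3 / 2 * (v 0 ^ 2 / A ^ 2) := by ring
        have e2 : 3 / 2 * v t ^ 2 / A ^ 2 = 3 / 2 * (v t ^ 2 / A ^ 2) := by ring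
        rw [e1, e2]
        linarith only [h1, ht.1])
  -- second barrier on `[tg, t₃]`
  have hK' : ∀ t ∈ Ico tg t₃, HasDerivWithinAt (fun y => (lam * (A + 2) - 1) * y)
      (lam * (A + 2) - 1) (Ici t) t := fun t _ => by
    simpa using ((hasDerivAt_id' t).const_mul (lam * (A + 2) - 1)).hasDerivWithinAt
  have hst2 : z t₃ ≤ Real.exp ((lam * (A + 2) - 1) * t₃ - (lam * (A + 2) - 1) * tg) *
      (z tg + 3 / 2 * ε * (A + 1) ^ 2 * (t₃ - tg)) :=
    seed_barrier (z := z) (Φ := fun y => (lam * (A + 2) - 1) * y)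
      (c := fun t => lam * (w t - y t) - ν) (q := fun t => ε * lam * w t ^ 2)
      (Φ' := fun _ => lam * (A + 2) - 1) htgt₃
      (hz.mono (Icc_subset_Icc htg0 ht3T)) (by fun_prop)
      (fun t ht => hz' t ⟨htg0.trans ht.1, ht.2.trans_le ht3T⟩) hK'
      (fun t ht => by
        have ht' : t ∈ Icc 0 T := ⟨htg0.trans ht.1, (ht.2.trans_le ht3T).le⟩
        exact core_pt_rate_flip hlam0 hν1 (hyb t ht') (hI t ht').2.2.2.2.2.1)
      (fun t ht => (hI t ⟨htg0.trans ht.1, ht.2.trans ht3T⟩).2.2.2.2.2.2.1)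
      (fun t ht => by
        have ht' : t ∈ Icc 0 T := ⟨htg0.trans ht.1, (ht.2.trans_le ht3T).le⟩
        exact core_pt_q2 hlam0 hlam2 hε.le hA (hI t ht').2.2.2.2.1 (hI t ht').2.2.2.2.2.1)
      (fun t ht => by
        show (lam * (A + 2) - 1) * tg ≤ (lam * (A + 2) - 1) * t
        exact mul_le_mul_of_nonneg_left ht.1 (by nlinarith only [hlam1, hA]))
  -- bookkeeping
  have hE1 : Real.exp (3 / 2 * v tg ^ 2 / A ^ 2 + 6 * tg - (3 / 2 * v 0 ^ 2 / A ^ 2 + 6 * 0)) ≤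
      Real.exp 4 := by
    refine Real.exp_le_exp.mpr ?_
    have e1 : 3 / 2 * v tg ^ 2 / A ^ 2 = 3 / 128 := by rw [hvtg]; field_simp; norm_num
    have e2 : 0 ≤ 3 / 2 * v 0 ^ 2 / A ^ 2 := by positivity
    linarith only [e1, e2, htgT, hT, htg0]
  have hKδ : (lam * (A + 2) - 1) * t₃ - (lam * (A + 2) - 1) * tg = (lam * (A + 2) - 1) * (t₃ - tg) := by
    ring
  rw [hKδ] at hst2
  have h16 : 16 * Real.log A / A ≤ 1 / 2 := by linarith only [hJ, ht3T, hT, ha0]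
  have hz00 : z 0 ≤ ε := hz0'.trans h32
  have hup : Real.log (z t₃) ≤ Real.log ε + 27 * Real.log A + 400 :=
    core_pt_zlog hA hε rfl hlogA0 h16 hz0 hz00 htg0 (htgT.trans hT) hE1 hst1
      (by nlinarith only [hlam2, hA]) (by linarith only [htgt₃]) (by linarith only [ht3tg]) hst2
      hz3pos
  ---------------------------------------------------------------- assembly
  refine ⟨fun t ht => ?_, ⟨tg, htgm, htgp, hvtg, fun t ht => (hrise t ht).2.1,
    fun t ht => ⟨(hIII t ht).1, (hIII t ht).2.1⟩, hIV⟩, hV, hz3pos, hlow, hup⟩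
  obtain ⟨h1, h2, h3, h4, h5, h6, h7, h8⟩ := hI t ht
  exact ⟨h1, by linarith only [h2], by linarith only [h3], by linarith only [h4], h5,
    by linarith only [h6], h7, h8⟩

end Summit.NavierStokesRegularity.NavierStokesRegularity.Theorems.PerpetualPumpCircuitPump
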